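import Summits.Schanuel.Schanuel.Theorems.ZilberEacConicConstFibre
import Summits.Schanuel.Schanuel.Theorems.ZilberEacSuperellipticResidueClass
import Summits.Schanuel.Schanuel.Theorems.ZilberEacSuperellipticSheets
import HarnessLib

/-!
# Arbitrary base branches, XLV: constant fibres over ALL curves `x₁^k = P(x₀)` — the summary

HONEST FRAMING.  Cell `pub-schanuel` (Zilber's Exponential-Algebraic Closedness, case ladder;
host summit Schanuel), seat 2, gen 29.  Bookkeeping over files XXII, XXX, XXXIV, XLIV: for `P`
monic of degree `M ≥ 1` with a simple root and `θ ≠ 0`, the cylinder `{x₁^k − P(x₀) = 0, y₀ = θ}`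
is in Mantova–Masser's case AND has Zariski-dense exponential points whenever
`k ≥ 3` (file XXXIV, every `θ`), or `k = 2` and: `M = 2` (the conics, file XLIV), or
`M ≢ 2 (mod 4)` (file XXII), or `θ` lies OFF the circle `M·log|θ| + Re p_{M−1} = 0` (file XXX).
**`unprojectedDensityQuestion_cyclicCover_constFibre`**.  The one remaining configuration —
`k = 2`, `M ≡ 2 (mod 4)`, `M ≥ 6`, `θ` ON the circle — is NOT decided here (it needs the next
coefficient of the phase expansion, cf. gens 22–24 for graphs).  Decided instances of an OPEN
question (Mantova–Masser, PLMS 2024 §1 p. 5); EC(3,2) OPEN; NOT Schanuel's conjecture (neither used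
nor implied); EAC ⇏ SC.
-/

noncomputable section

open Filter Topology Set Complex Polynomial
open Literature.NumberTheory.Transcendental Literature.ModelTheory.Zilber
open Literature.ModelTheory.ExponentialFields

set_option linter.dupNamespace false

namespace Summit.Schanuel.Schanuel.Theorems

section CyclicCover

variable (P : Polynomial ℂ)

/-- **Constant fibres over the cyclic covers `x₁^k = P(x₀)`: the decided configurations.**  `k ≥ 2`,
`P` monic of degree `M ≥ 1` with a simple root, `θ ≠ 0`, and one of: `k ≥ 3`; `M = 2`;
`M % 4 ≠ 2`; `M·log|θ| + Re p_{M−1} ≠ 0`.  Then `{x₁^k − P(x₀) = 0, y₀ = θ}` is in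
Mantova–Masser's case AND dense. [cite: MantovaMasser2023, §1 Further remarks, p. 5 (the question,
open in general)] (new) -/
theorem unprojectedDensityQuestion_cyclicCover_constFibre {k : ℕ} (hk : 2 ≤ k) (hP : P.Monic)
    (hM : 1 ≤ P.natDegree) {r : ℂ} (hr : P.IsRoot r) (hr1 : P.derivative.eval r ≠ 0) {θ : ℂ}
    (hθ : θ ≠ 0)
    (hconf : 3 ≤ k ∨ P.natDegree = 2 ∨ P.natDegree % 4 ≠ 2 ∨
      (P.natDegree : ℝ) * Real.log ‖θ‖ + (P.coeff (P.natDegree - 1)).re ≠ 0) :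
    MMCaseDimPiOneFree {w : Fin 2 ⊕ Fin 2 → ℂ |
        w (Sum.inl 1) ^ k - P.eval (w (Sum.inl 0)) = 0 ∧ w (Sum.inr 0) = θ} ∧
      UnprojectedDense {w : Fin 2 ⊕ Fin 2 → ℂ |
        w (Sum.inl 1) ^ k - P.eval (w (Sum.inl 0)) = 0 ∧ w (Sum.inr 0) = θ} := by
  by_cases hk3 : 3 ≤ k
  · exact unprojectedDensityQuestion_superelliptic_constFibre_all P hk3 hP hM hr hr1 hθ
  have hk2 : k = 2 := by omega
  subst hk2
  rcases hconf with h | h | h | h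
  · exact absurd h hk3
  · exact unprojectedDensityQuestion_conic_constFibre P hP h hr hr1 hθ
  · refine unprojectedDensityQuestion_superelliptic_constFibre' P le_rfl hP hM hr hr1 ?_ hθ
    rintro ⟨-, h4⟩
    rw [Nat.mul_div_cancel_left _ (by norm_num : 0 < 2)] at h4
    exact h h4
  · by_cases hM2 : P.natDegree = 2
    · exact unprojectedDensityQuestion_conic_constFibre P hP hM2 hr hr1 hθ
    by_cases hM1 : P.natDegree = 1
    · refine unprojectedDensityQuestion_superelliptic_constFibre' P le_rfl hP hM hr hr1 ?_ hθ
      rintro ⟨-, h4⟩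
      rw [hM1] at h4
      norm_num at h4
    · exact unprojectedDensityQuestion_superelliptic_constFibre_offCircle' P le_rfl hP (by omega) hr
        hr1 hθ h

/-- Example: `{x₁² = x₀² + 1, y₀ = θ}` (a conic) — case ∧ dense for every `θ ≠ 0`.
[cite: MantovaMasser2023, §1 Further remarks, p. 5 (the question, open in general)] (new) -/
theorem unprojectedDensityQuestion_unitHyperbola_constFibre {θ : ℂ} (hθ : θ ≠ 0) :
    MMCaseDimPiOneFree {w : Fin 2 ⊕ Fin 2 → ℂ |
        w (Sum.inl 1) ^ 2 - (Polynomial.X ^ 2 + 1 : Polynomial ℂ).eval (w (Sum.inl 0)) = 0 ∧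
        w (Sum.inr 0) = θ} ∧
      UnprojectedDense {w : Fin 2 ⊕ Fin 2 → ℂ |
        w (Sum.inl 1) ^ 2 - (Polynomial.X ^ 2 + 1 : Polynomial ℂ).eval (w (Sum.inl 0)) = 0 ∧
        w (Sum.inr 0) = θ} := by
  have hmonic : (Polynomial.X ^ 2 + 1 : Polynomial ℂ).Monic := by
    simpa using Polynomial.monic_X_pow_add_C (1 : ℂ) (by norm_num : (2 : ℕ) ≠ 0)
  have hdeg : (Polynomial.X ^ 2 + 1 : Polynomial ℂ).natDegree = 2 := by
    simpa using Polynomial.natDegree_X_pow_add_C (n := 2) (r := (1 : ℂ))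
  have hroot : (Polynomial.X ^ 2 + 1 : Polynomial ℂ).IsRoot I := by
    simp [Polynomial.IsRoot, Complex.I_sq]
  have hder : (Polynomial.derivative (Polynomial.X ^ 2 + 1 : Polynomial ℂ)).eval I ≠ 0 := by
    rw [Polynomial.derivative_add, Polynomial.derivative_one, Polynomial.derivative_X_pow, add_zero,
      Polynomial.eval_mul, Polynomial.eval_C, Polynomial.eval_pow, Polynomial.eval_X]
    simp [Complex.I_ne_zero]
  exact unprojectedDensityQuestion_cyclicCover_constFibre _ le_rfl hmonic (by omega) hroot hder hθ
    (Or.inr (Or.inl hdeg))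

end CyclicCover

end Summit.Schanuel.Schanuel.Theorems

end
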